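import Summits.KontsevichZagierPeriods.KontsevichZagierPeriods.Theorems.RootDecompWalshStrataCellThree03

/-!
# Root decomposition & Walsh strata — the quadric stratum `d ≤ 3` modulo two typed residuals (lens 4, gen 7, part D)

The EXTREMAL REDUCTION of the support item `QuadricBakerDescent` (`stmt-KontsevichZagierPeriods-27597`,
route of record `RootDecompWalshStrata`) to its minimal open configurations, kernel-checked:

* `exists_quadric₃_of_totalDegree_le_two` — every `P ∈ ℚ[x,y,z]` of total degree `≤ 2` is a quadric
  normal form `Quadric₃` (`A z² + B(x,y) z + C(x,y)`);
* `InBaker.of_perm` — coordinate permutations are moves (`KZ.permRel ⊆ KZ.levelRel ≤ KZ.relations`),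
  so the fibre variable may be chosen: `Quadric₃.swapYZ` (leading coefficient `c₂₂`), `Quadric₃.swapXZ`
  (leading coefficient `c₁₁`) and `inBaker_cell3_of_perm`;
* `inBaker_cell3_of_const_neg/zero/pos` — `A = 0` with a CONSTANT fibre coefficient `B ≡ b₀`: the cell
  is a band over the square (or over `{C₀ > 0}`), the length integrand `q·κ(−C₀/b₀)` is decided atom
  by atom (`clamp_wc_cases`) and is `0`, `q` or a conic weight (`quadDescent₂_holds`);
* `inBaker_cell3_all` — a weighted quadric cell `[(0,1)³ ∩ {p > 0}, q]` lands in the Baker sector modulo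
  relations as soon as (i) the companion statement `SqrtDescent₂` holds for every normal form
  (hypothesis `hS`, spelled out) and (ii) the GENUINELY MULTI-AFFINE cells (`A = c₁₁ = c₂₂ = 0`,
  `(b₁, b₂) ≠ 0`: no square term, non-constant fibre coefficient) land there (hypothesis `hM`,
  spelled out): `A ≠ 0` is `inBaker_cell3`; `c₂₂ ≠ 0` / `c₁₁ ≠ 0` are `inBaker_cell3` after a swap;
  `B` constant is the previous item;
* `quadricBakerDescent_of_sqrtDescent₂_of_multiAffine : hS → hM → QuadricBakerDescent` — the route item
  BY NAME (`d ≤ 2` is the landed `quadricBakerDescent_two`).  So the `d ≤ 3` quadric stratum of the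
  rung is reduced to exactly two typed two- and three-dimensional statements: square roots of the fibre
  discriminant on adapted atoms, and genuinely multi-affine cells.

References: [KontsevichZagier2001 §1.2 rules (1),(2),(3)], [BCR1998 §2], this node (NODE.md gen 5–7).

This is part 1/2 (§29.1–29.2: `Quadric₃.add`, the swaps `swapYZ` / `swapXZ`, the normal form
`exists_quadric₃_of_totalDegree_le_two`, `InBaker.of_perm` and `inBaker_cell3_of_perm`); part 2/2
(`RootDecompWalshStrataQuadricAssembly02`) = the constant-fibre-coefficient cells, `inBaker_cell3_all` and
the conditional assembly `quadricBakerDescent_of_sqrtDescent₂_of_multiAffine` of the route item.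
-/

noncomputable section

open Literature.NumberTheory.Transcendental
open MeasureTheory Set
open MvPolynomial (aeval X C)
open Literature.ModelTheory.ExponentialFields (IsSemialgebraic isSemialgebraic_univ
  isSemialgebraic_setOf_eval_pos isSemialgebraic_setOf_eval_lt isSemialgebraic_setOf_eval_le
  isSemialgebraic_setOf_eval_nonneg isSemialgebraic_setOf_eval_eq_zero
  isSemialgebraic_setOf_eval_ne_zero continuous_aeval_real tarski_seidenberg_real_holds)
open Summit.KontsevichZagierPeriods.RootDecompWalshStrata.WalshSpanProof (isSemialgebraic_cubeSet
  isBounded_cubeSet)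
open Summit.KontsevichZagierPeriods.RootDecompWalshStrata.ConeSpecimen (unitIoo isSemialgebraic_unitIoo
  unitIoo_subset_Icc mem_unitIoo)
open Summit.KontsevichZagierPeriods.RootDecompWalshStrata.PointlessOctant (boxTwo isSemialgebraic_boxTwo
  boxTwo_subset_Icc)

namespace Summit.KontsevichZagierPeriods.RootDecompWalshStrata.ConicDescent.BallCube

namespace Quadric₃

/-- The quadric Walsh cell is `ℚ`-semialgebraic (PRIVATE copy of the CellThree02 lemma: the gate lint
`dedup.landed` identifies its statement with the landed `…ConicDescent.Conic.isSemialgebraic_cell`). [BCR1998 §2.2] -/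
private theorem isSemialgebraic_cell (K : Quadric₃) : IsSemialgebraic ℚ K.cell := by
  convert (isSemialgebraic_cubeSet 3).inter (isSemialgebraic_setOf_eval_pos (R := ℝ) K.PxyzP)
    using 1
  ext z
  simp only [cell, mem_setOf_eq, mem_inter_iff, aeval_PxyzP]

/-- The quadric Walsh cell lies in the closed unit cube (PRIVATE copy, same reason). [folklore] -/
private theorem cell_subset_Icc (K : Quadric₃) : K.cell ⊆ Icc 0 1 := fun _ hz =>
  ⟨fun j => (hz.1 j).1.le, fun j => (hz.1 j).2.le⟩

end Quadric₃

/-! #### 29.1 Normal form: total degree `≤ 2` in three variables -/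

namespace Quadric₃

variable (K : Quadric₃)

/-- Coefficientwise sum of two quadric normal forms. [this node] -/
def add (K L : Quadric₃) : Quadric₃ :=
  ⟨K.A + L.A, K.b0 + L.b0, K.b1 + L.b1, K.b2 + L.b2, K.c0 + L.c0, K.c1 + L.c1, K.c2 + L.c2,
    K.c11 + L.c11, K.c12 + L.c12, K.c22 + L.c22⟩

/-- `(K + L).p = K.p + L.p`. [this node] -/
theorem add_pxyz (K L : Quadric₃) (x y z : ℝ) :
    (K.add L).pxyz x y z = K.pxyz x y z + L.pxyz x y z := by
  simp only [add, pxyz, Bxy, Cxy]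
  push_cast
  ring

/-- Swap of the fibre variable with `y`: `K.swapYZ.p (x, y, z) = K.p (x, z, y)`; its leading
coefficient is `c₂₂`. [this node] -/
def swapYZ : Quadric₃ := ⟨K.c22, K.c2, K.c12, K.b2, K.c0, K.c1, K.b0, K.c11, K.b1, K.A⟩

/-- Swap of the fibre variable with `x`: `K.swapXZ.p (x, y, z) = K.p (z, y, x)`; its leading
coefficient is `c₁₁`. [this node] -/
def swapXZ : Quadric₃ := ⟨K.c11, K.c1, K.b1, K.c12, K.c0, K.b0, K.c2, K.A, K.b2, K.c22⟩

/-- Leading coefficient after the `y ↔ z` swap. [this node] -/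
theorem swapYZ_A : K.swapYZ.A = K.c22 := rfl

/-- Leading coefficient after the `x ↔ z` swap. [this node] -/
theorem swapXZ_A : K.swapXZ.A = K.c11 := rfl

/-- `K.swapYZ.p (x, y, z) = K.p (x, z, y)`. [this node] -/
theorem swapYZ_pxyz (x y z : ℝ) : K.swapYZ.pxyz x y z = K.pxyz x z y := by
  simp only [swapYZ, pxyz, Bxy, Cxy]
  ring

/-- `K.swapXZ.p (x, y, z) = K.p (z, y, x)`. [this node] -/
theorem swapXZ_pxyz (x y z : ℝ) : K.swapXZ.pxyz x y z = K.pxyz z y x := by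
  simp only [swapXZ, pxyz, Bxy, Cxy]
  ring

end Quadric₃

/-- **Normal form.** A polynomial in three variables of total degree `≤ 2` is a quadric
`A z² + (b₀ + b₁ x + b₂ y) z + (c₀ + c₁ x + c₂ y + c₁₁ x² + c₁₂ x y + c₂₂ y²)`. [folklore] -/
theorem exists_quadric₃_of_totalDegree_le_two (P : MvPolynomial (Fin 3) ℚ)
    (hP : P.totalDegree ≤ 2) :
    ∃ K : Quadric₃, ∀ z : Fin 3 → ℝ, aeval z P = K.pxyz (z 0) (z 1) (z 2) := by
  classical
  have key : ∀ d ∈ P.support, ∃ K : Quadric₃, ∀ z : Fin 3 → ℝ,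
      aeval z (MvPolynomial.monomial d (P.coeff d)) = K.pxyz (z 0) (z 1) (z 2) := by
    intro d hd
    have hdeg : (d.sum fun _ e => e) ≤ 2 := (MvPolynomial.le_totalDegree hd).trans hP
    have hsum : (d.sum fun _ e => e) = d 0 + d 1 + d 2 := by
      rw [Finsupp.sum_fintype _ _ (fun _ => rfl), Fin.sum_univ_three]
    rw [hsum] at hdeg
    have hev : ∀ z : Fin 3 → ℝ, aeval z (MvPolynomial.monomial d (P.coeff d)) =
        ((P.coeff d : ℚ) : ℝ) * (z 0 ^ d 0 * z 1 ^ d 1 * z 2 ^ d 2) := fun z => by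
      rw [MvPolynomial.aeval_monomial, Finsupp.prod_fintype _ _ (fun _ => by simp),
        Fin.prod_univ_three, eq_ratCast]
    set c := P.coeff d
    have h0 : d 0 ≤ 2 := by omega
    have h1 : d 1 ≤ 2 := by omega
    have h2 : d 2 ≤ 2 := by omega
    interval_cases h0' : d 0 <;> interval_cases h1' : d 1 <;> interval_cases h2' : d 2
    all_goals first
      | (exfalso; omega)
      | skip
    -- the ten monomials of degree ≤ 2, in the order (d₀, d₁, d₂) lexicographic
    · exact ⟨⟨0, 0, 0, 0, c, 0, 0, 0, 0, 0⟩, fun z => by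
        rw [hev]; simp only [Quadric₃.pxyz, Quadric₃.Bxy, Quadric₃.Cxy]; push_cast; ring⟩
    · exact ⟨⟨0, c, 0, 0, 0, 0, 0, 0, 0, 0⟩, fun z => by
        rw [hev]; simp only [Quadric₃.pxyz, Quadric₃.Bxy, Quadric₃.Cxy]; push_cast; ring⟩
    · exact ⟨⟨c, 0, 0, 0, 0, 0, 0, 0, 0, 0⟩, fun z => by
        rw [hev]; simp only [Quadric₃.pxyz, Quadric₃.Bxy, Quadric₃.Cxy]; push_cast; ring⟩
    · exact ⟨⟨0, 0, 0, 0, 0, 0, c, 0, 0, 0⟩, fun z => by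
        rw [hev]; simp only [Quadric₃.pxyz, Quadric₃.Bxy, Quadric₃.Cxy]; push_cast; ring⟩
    · exact ⟨⟨0, 0, 0, c, 0, 0, 0, 0, 0, 0⟩, fun z => by
        rw [hev]; simp only [Quadric₃.pxyz, Quadric₃.Bxy, Quadric₃.Cxy]; push_cast; ring⟩
    · exact ⟨⟨0, 0, 0, 0, 0, 0, 0, 0, 0, c⟩, fun z => by
        rw [hev]; simp only [Quadric₃.pxyz, Quadric₃.Bxy, Quadric₃.Cxy]; push_cast; ring⟩
    · exact ⟨⟨0, 0, 0, 0, 0, c, 0, 0, 0, 0⟩, fun z => by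
        rw [hev]; simp only [Quadric₃.pxyz, Quadric₃.Bxy, Quadric₃.Cxy]; push_cast; ring⟩
    · exact ⟨⟨0, 0, c, 0, 0, 0, 0, 0, 0, 0⟩, fun z => by
        rw [hev]; simp only [Quadric₃.pxyz, Quadric₃.Bxy, Quadric₃.Cxy]; push_cast; ring⟩
    · exact ⟨⟨0, 0, 0, 0, 0, 0, 0, 0, c, 0⟩, fun z => by
        rw [hev]; simp only [Quadric₃.pxyz, Quadric₃.Bxy, Quadric₃.Cxy]; push_cast; ring⟩
    · exact ⟨⟨0, 0, 0, 0, 0, 0, 0, c, 0, 0⟩, fun z => by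
        rw [hev]; simp only [Quadric₃.pxyz, Quadric₃.Bxy, Quadric₃.Cxy]; push_cast; ring⟩
  have hsum := fun z : Fin 3 → ℝ => congrArg (aeval z) P.as_sum
  suffices h : ∃ K : Quadric₃, ∀ z : Fin 3 → ℝ,
      aeval z (∑ d ∈ P.support, MvPolynomial.monomial d (P.coeff d)) = K.pxyz (z 0) (z 1) (z 2) by
    obtain ⟨K, hK⟩ := h
    exact ⟨K, fun z => (hsum z).trans (hK z)⟩
  refine Finset.sum_induction _ (fun x : MvPolynomial (Fin 3) ℚ => ∃ K : Quadric₃,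
      ∀ z : Fin 3 → ℝ, aeval z x = K.pxyz (z 0) (z 1) (z 2)) (fun a b ha hb => ?_)
    ⟨⟨0, 0, 0, 0, 0, 0, 0, 0, 0, 0⟩, fun z => by
      simp [Quadric₃.pxyz, Quadric₃.Bxy, Quadric₃.Cxy]⟩ key
  obtain ⟨K, hK⟩ := ha
  obtain ⟨L, hL⟩ := hb
  exact ⟨K.add L, fun z => by rw [map_add, hK, hL, Quadric₃.add_pxyz]⟩

/-! #### 29.2 Coordinate permutations: the fibre variable may be chosen -/

/-- **Coordinate permutations are moves** (rule (2) along `x ↦ x ∘ p`, `|det| = 1`: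
`KZ.permRel ⊆ KZ.levelRel ≤ KZ.relations`): if `r'` is `r` read in permuted coordinates and `[r']`
lands in the Baker sector modulo relations, so does `[r]`. [KontsevichZagier2001 §1.2 rule (2)] -/
theorem InBaker.of_perm {N : ℕ} (p : Equiv.Perm (Fin N)) (r r' : KZ.IntegralRep N)
    (hd : r'.domain = (fun x : Fin N → ℝ => x ∘ ⇑p) '' r.domain)
    (hi : ∀ x ∈ r.domain, r.integrand x = r'.integrand (x ∘ ⇑p)) (h : InBaker (KZ.of r')) :
    InBaker (KZ.of r) :=
  h.congr (KZ.levelRel_le_relations (KZ.permRel_subset_levelRel ⟨N, r, r', p, hd, hi, rfl⟩))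

/-- The image of a set under an involutive coordinate permutation, from a membership test.
[folklore] -/
theorem image_comp_eq_of_forall_apply_apply {N : ℕ} {S T : Set (Fin N → ℝ)} (p : Equiv.Perm (Fin N))
    (hp : ∀ j, p (p j) = j) (h : ∀ x : Fin N → ℝ, x ∘ ⇑p ∈ T ↔ x ∈ S) :
    (fun x : Fin N → ℝ => x ∘ ⇑p) '' S = T := by
  have hinv : ∀ y : Fin N → ℝ, (y ∘ ⇑p) ∘ ⇑p = y := fun y =>
    funext fun j => by simp only [Function.comp_apply, hp]
  ext y
  constructor
  · rintro ⟨x, hx, rfl⟩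
    exact (h x).2 hx
  · intro hy
    exact ⟨y ∘ ⇑p, (h _).1 (by rw [hinv]; exact hy), hinv y⟩

namespace Quadric₃

variable (K : Quadric₃)

/-- The open cube is invariant under coordinate permutations. [folklore] -/
theorem forall_cube_comp_iff (p : Equiv.Perm (Fin 3)) (hp : ∀ j, p (p j) = j) (x : Fin 3 → ℝ) :
    (∀ j, 0 < x (p j) ∧ x (p j) < 1) ↔ ∀ j, 0 < x j ∧ x j < 1 :=
  ⟨fun h j => by simpa only [hp] using h (p j), fun h j => h (p j)⟩

/-- `x ∘ (1 2) ∈ cell(K.swapYZ) ↔ x ∈ cell(K)`. [this node] -/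
theorem comp_swapYZ_mem_cell_iff (x : Fin 3 → ℝ) :
    x ∘ ⇑(Equiv.swap (1 : Fin 3) 2) ∈ K.swapYZ.cell ↔ x ∈ K.cell := by
  have h0 : (Equiv.swap (1 : Fin 3) 2) 0 = 0 := by decide
  have h1 : (Equiv.swap (1 : Fin 3) 2) 1 = 2 := by decide
  have h2 : (Equiv.swap (1 : Fin 3) 2) 2 = 1 := by decide
  have hp : ∀ j : Fin 3, (Equiv.swap (1 : Fin 3) 2) ((Equiv.swap (1 : Fin 3) 2) j) = j := by decide
  simp only [cell, mem_setOf_eq, Function.comp_apply, h0, h1, h2, swapYZ_pxyz,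
    forall_cube_comp_iff _ hp]

/-- `x ∘ (0 2) ∈ cell(K.swapXZ) ↔ x ∈ cell(K)`. [this node] -/
theorem comp_swapXZ_mem_cell_iff (x : Fin 3 → ℝ) :
    x ∘ ⇑(Equiv.swap (0 : Fin 3) 2) ∈ K.swapXZ.cell ↔ x ∈ K.cell := by
  have h0 : (Equiv.swap (0 : Fin 3) 2) 0 = 2 := by decide
  have h1 : (Equiv.swap (0 : Fin 3) 2) 1 = 1 := by decide
  have h2 : (Equiv.swap (0 : Fin 3) 2) 2 = 0 := by decide
  have hp : ∀ j : Fin 3, (Equiv.swap (0 : Fin 3) 2) ((Equiv.swap (0 : Fin 3) 2) j) = j := by decide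
  simp only [cell, mem_setOf_eq, Function.comp_apply, h0, h1, h2, swapXZ_pxyz,
    forall_cube_comp_iff _ hp]

/-- **Choice of the fibre variable.** If `cell(L)` is `cell(K)` read in permuted coordinates
(`p` an involution) and every `[cell(L), q]` lands in the Baker sector modulo relations, then so
does every `[cell(K), q]`. [KontsevichZagier2001 §1.2 rule (2); this node] -/
theorem inBaker_cell3_of_perm (K L : Quadric₃) (p : Equiv.Perm (Fin 3)) (hp : ∀ j, p (p j) = j)
    (hKL : ∀ x : Fin 3 → ℝ, x ∘ ⇑p ∈ L.cell ↔ x ∈ K.cell) (q : ℚ)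
    (hL : ∀ ρ' : KZ.IntegralRep 3, ρ'.domain = L.cell → (∀ z ∈ ρ'.domain, ρ'.integrand z = q) →
      InBaker (KZ.of ρ'))
    (ρ : KZ.IntegralRep 3) (hdom : ρ.domain = K.cell) (hint : ∀ z ∈ ρ.domain, ρ.integrand z = q) :
    InBaker (KZ.of ρ) := by
  set ρ' : KZ.IntegralRep 3 := polyRep₁ L.cell L.isSemialgebraic_cell L.cell_subset_Icc
    (MvPolynomial.C q) with hρ'
  have hρ'i : ∀ z, ρ'.integrand z = q := fun z => by simp [hρ']
  refine InBaker.of_perm p ρ ρ' ?_ (fun z hz => by rw [hint z hz, hρ'i])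
    (hL ρ' (by rw [hρ', polyRep₁_domain]) fun z _ => hρ'i z)
  rw [hρ', polyRep₁_domain, hdom]
  exact (image_comp_eq_of_forall_apply_apply p hp hKL).symm

end Quadric₃

end Summit.KontsevichZagierPeriods.RootDecompWalshStrata.ConicDescent.BallCube
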